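import Mathlib
import HarnessLib.Audit
import Summits.PneNP.PneNP.Theorems.ClusHilbertPhi

/-!
# Route ClusUniversalCertificate — sublevel sets of a predictor are independent: `HF_Y(d) ≥ #{y ∈ Y : |φ_g(y)| ≤ d}` and `2Φ(Y) ≤ cap(Y)`
(rung F-N1, cell pnp-ideate, crux `UniversalCertAll` = stmt-PneNP-19683; planner p1 g13, `HOME/pnp-ideate-p1/lines/hilbert-TII.md` §2 Cor 6
and §3 Thm 7; the typed statements `card_filter_predErr_le_HF`, `Phi_le_sum_predErr`, `two_Phi_le_capId` of `lines/hilbert-TII-UNREGISTERED.lean`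
with `HF`, `Phi`, `predErr`, `capId` VERBATIM; restricted-model combinatorics — nothing here bears on `P` versus `NP`)

The SURJECTIVE half of the nonlinear Lemma Z.  `ClusHilbertLemmaZ.eq_zero_of_vanish_on_sublevel` says that evaluation of the degree-`≤ d` functions
`Pdeg univ d` on the sublevel set `B_d = {y : |φ_g(y)| ≤ d}` is injective; here we count dimensions — the monomial functions `x_S` are linearly
independent (`chi_linearIndependent`, evaluate at the indicator point of a minimal `S`), so `dim Pdeg univ d = #{S : #S ≤ d}`, and the error-set
map `y ↦ {t : y_t ≠ g_t(y_{<t})}` is injective (`eq_of_errSet_eq`, the triangular bijection), so `#B_d ≤ #{S : #S ≤ d}` — hence evaluation on `B_d` is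
BIJECTIVE (`evalB_surjective`): `B_d` is an interpolation set for degree `≤ d`.  Consequences (hilbert-TII.md Cor 6, Thm 7):

* `card_filter_predErr_le_HF` — `#{y ∈ Y : |φ_g(y)| ≤ d} ≤ HF_Y(d)`;
* `Phi_le_sum_predErr` — `Φ(Y) ≤ Σ_{y∈Y} |φ_g(y)|` for every triangular predictor;
* `two_Phi_le_capId` — with the majority predictor (`ClusHilbertBound.two_mul_sum_predErr_maj`): `2Φ(Y) ≤ cap_id(Y)`.  Together with
  `ClusHilbertPhi.sum_dimAt_le_two_Phi` this is Theorem 7 in its sharp form `Σ_y dim_Y(y) ≤ 2Φ(Y) ≤ cap_σ(Y)`: ONE affine-invariant number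
  `2Φ(Y)` sits below the prefix-tree capacity of EVERY coordinate order.
-/

set_option linter.dupNamespace false -- `Summit.PneNP.PneNP.…`: summit = sub-problem name (D-0017 single-conjunct layout)

namespace Summit.PneNP.PneNP.Theorems.ClusHilbert

open Finset MvPolynomial
open Summit.PneNP.PneNP.Theorems.ClusCube (V pt sum_eq_sum_card_lt)

variable {N : ℕ}

/-- Every element of `ZMod 2` is `0` or `1`. -/
private theorem zmod2_eq_zero_or_one (z : ZMod 2) : z = 0 ∨ z = 1 := by
  fin_cases z
  · exact Or.inl rfl
  · exact Or.inr rfl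

/-! ## The monomial functions are linearly independent -/

/-- `x_S` at the indicator point of `T` is `[S ⊆ T]`. -/
theorem chi_pt (S T : Finset (Fin N)) : chi S (pt T) = if S ⊆ T then 1 else 0 := by
  unfold chi pt
  by_cases h : S ⊆ T
  · rw [if_pos h]
    exact prod_eq_one fun i hi => by rw [if_pos (h hi)]
  · rw [if_neg h]
    obtain ⟨i, hiS, hiT⟩ := not_subset.mp h
    exact prod_eq_zero hiS (by rw [if_neg hiT])

/-- **The multilinear monomial functions `x_S` are linearly independent** (evaluate a dependency at the indicator point of a member of minimum
cardinality). -/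
theorem chi_linearIndependent : LinearIndependent (ZMod 2) (fun S : Finset (Fin N) => chi S) := by
  classical
  rw [linearIndependent_iff']
  intro s c hsum T hT
  by_contra hcT
  set S' := s.filter fun S => c S ≠ 0 with hS'
  have hne : S'.Nonempty := ⟨T, by rw [hS']; exact mem_filter.mpr ⟨hT, hcT⟩⟩
  obtain ⟨T₀, hT₀, hmin⟩ := S'.exists_min_image Finset.card hne
  have hT₀s : T₀ ∈ s := (mem_filter.mp hT₀).1
  have hcT₀ : c T₀ ≠ 0 := (mem_filter.mp hT₀).2
  have h := congrFun hsum (pt T₀)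
  rw [Finset.sum_apply, Pi.zero_apply, sum_eq_single_of_mem T₀ hT₀s] at h
  · rw [Pi.smul_apply, smul_eq_mul, chi_pt, if_pos (Subset.refl _), mul_one] at h
    exact hcT₀ h
  · intro S hS hST
    rw [Pi.smul_apply, smul_eq_mul, chi_pt]
    by_cases hsub : S ⊆ T₀
    · -- a proper subset of `T₀` with non-zero coefficient would be smaller
      by_cases hc : c S = 0
      · rw [hc, zero_mul]
      · exfalso
        have hlt : S.card < T₀.card := card_lt_card (Finset.ssubset_iff_subset_ne.mpr ⟨hsub, hST⟩)
        have := hmin S (by rw [hS']; exact mem_filter.mpr ⟨hS, hc⟩)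
        omega
    · rw [if_neg hsub, mul_zero]

/-- The degree filtration is the span of the independent family of small monomials. -/
theorem Pdeg_univ_eq_span (d : ℕ) :
    Pdeg (univ : Finset (Fin N)) d = Submodule.span (ZMod 2) (Set.range fun S : {S : Finset (Fin N) // S.card ≤ d} => chi S.1) := by
  unfold Pdeg
  congr 1
  ext f
  constructor
  · rintro ⟨S, -, hc, rfl⟩
    exact ⟨⟨S, hc⟩, rfl⟩
  · rintro ⟨⟨S, hc⟩, rfl⟩
    exact ⟨S, subset_univ _, hc, rfl⟩

/-- **`dim Pdeg univ d = #{S : #S ≤ d}`.** -/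
theorem finrank_Pdeg_univ (d : ℕ) :
    Module.finrank (ZMod 2) (Pdeg (univ : Finset (Fin N)) d) = Fintype.card {S : Finset (Fin N) // S.card ≤ d} := by
  rw [Pdeg_univ_eq_span]
  exact finrank_span_eq_card (chi_linearIndependent.comp (fun S : {S : Finset (Fin N) // S.card ≤ d} => S.1) Subtype.val_injective)

/-! ## The error-set map is injective (the triangular bijection) -/

/-- Two points with the same error pattern under a triangular predictor are equal. -/
theorem eq_of_errSet_eq (g : (t : Fin N) → (Fin t → ZMod 2) → ZMod 2) {y y' : V N}
    (h : ∀ t, (y t ≠ g t (pre y t) ↔ y' t ≠ g t (pre y' t))) : y = y' := by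
  have key : ∀ k, ∀ t : Fin N, t.val < k → y t = y' t := by
    intro k
    induction k with
    | zero => intro t ht; exact absurd ht (Nat.not_lt_zero _)
    | succ k ih =>
      intro t ht
      by_cases hlt : t.val < k
      · exact ih t hlt
      · have hpre : pre y t = pre y' t := funext fun i => ih _ (by
          have : (Fin.castLT i (lt_trans i.isLt t.isLt) : Fin N).val = i.val := rfl
          have := i.isLt; omega)
        have ht' := h t
        rw [hpre] at ht'
        rcases zmod2_eq_zero_or_one (y t) with h0 | h1 <;>
          rcases zmod2_eq_zero_or_one (y' t) with h0' | h1' <;>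
          rcases zmod2_eq_zero_or_one (g t (pre y' t)) with hg | hg
        all_goals first
          | (rw [h0, h0'])
          | (rw [h1, h1'])
          | (exfalso; rw [h0, h1', hg] at ht'; exact absurd ht' (by decide))
          | (exfalso; rw [h1, h0', hg] at ht'; exact absurd ht' (by decide))
  funext t
  exact key N t t.isLt

/-- the set of coordinates the predictor gets wrong on `y` -/
def errSet (g : (t : Fin N) → (Fin t → ZMod 2) → ZMod 2) (y : V N) : Finset (Fin N) :=
  univ.filter fun t => y t ≠ g t (pre y t)

/-- The error set has `predErr` elements. -/
theorem card_errSet (g : (t : Fin N) → (Fin t → ZMod 2) → ZMod 2) (y : V N) : (errSet g y).card = predErr g y := rfl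

/-- The error-set map is injective. -/
theorem errSet_injective (g : (t : Fin N) → (Fin t → ZMod 2) → ZMod 2) : Function.Injective (errSet g) := by
  intro y y' h
  refine eq_of_errSet_eq g fun t => ?_
  have := Finset.ext_iff.mp h t
  simpa [errSet] using this

/-! ## Evaluation on the sublevel set is bijective -/

/-- restriction of functions on the cube to a finite set of points -/
def resTo (B : Finset (V N)) : (V N → ZMod 2) →ₗ[ZMod 2] (B → ZMod 2) where
  toFun f := fun v => f v
  map_add' _ _ := rfl
  map_smul' _ _ := rfl

/-- **`B_d` is an interpolation set for degree `≤ d`**: every function on the sublevel set `{y : |φ_g(y)| ≤ d}` is the restriction of a function of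
degree `≤ d`. -/
theorem evalB_surjective (g : (t : Fin N) → (Fin t → ZMod 2) → ZMod 2) (d : ℕ) :
    Function.Surjective ((resTo (univ.filter fun y : V N => predErr g y ≤ d)).domRestrict (Pdeg (univ : Finset (Fin N)) d)) := by
  classical
  set B := univ.filter fun y : V N => predErr g y ≤ d with hB
  set L := (resTo B).domRestrict (Pdeg (univ : Finset (Fin N)) d) with hL
  -- injective, by the nonlinear Lemma Z
  have hinj : Function.Injective L := by
    rw [← LinearMap.ker_eq_bot, LinearMap.ker_eq_bot']
    intro f hf
    apply Subtype.ext
    refine eq_zero_of_vanish_on_sublevel g d f.1 f.2 fun y hy => ?_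
    have hyB : y ∈ B := by rw [hB]; exact mem_filter.mpr ⟨mem_univ _, hy⟩
    exact congrFun hf ⟨y, hyB⟩
  -- dimensions: `dim Pdeg = #{S : #S ≤ d} ≥ #B`
  have h1 : Module.finrank (ZMod 2) (Pdeg (univ : Finset (Fin N)) d) ≤ Module.finrank (ZMod 2) (B → ZMod 2) :=
    LinearMap.finrank_le_finrank_of_injective hinj
  have h2 : Module.finrank (ZMod 2) (B → ZMod 2) ≤ Module.finrank (ZMod 2) (Pdeg (univ : Finset (Fin N)) d) := by
    rw [Module.finrank_pi, Fintype.card_coe, finrank_Pdeg_univ]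
    -- inject `B` into the small sets through the error set
    let ι : B → {S : Finset (Fin N) // S.card ≤ d} := fun y => ⟨errSet g y.1, by
      rw [card_errSet]; exact (mem_filter.mp y.2).2⟩
    have hι : Function.Injective ι := by
      intro y y' h
      apply Subtype.ext
      exact errSet_injective g (congrArg Subtype.val h)
    have := Fintype.card_le_of_injective ι hι
    rwa [Fintype.card_coe] at this
  exact (LinearMap.injective_iff_surjective_of_finrank_eq_finrank (le_antisymm h1 h2)).mp hinj

/-! ## Low-degree functions are polynomial functions of low total degree -/

/-- evaluation as a linear map from polynomials to functions on the cube -/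
noncomputable def evalFun : MvPolynomial (Fin N) (ZMod 2) →ₗ[ZMod 2] (V N → ZMod 2) where
  toFun p := fun x => MvPolynomial.eval x p
  map_add' := by intro p q; funext x; simp
  map_smul' := by intro c p; funext x; simp

/-- Every function of degree `≤ d` is the function of a polynomial of total degree `≤ d` (the square-free monomials). -/
theorem exists_poly_of_mem_Pdeg {d : ℕ} {f : V N → ZMod 2} (hf : f ∈ Pdeg (univ : Finset (Fin N)) d) :
    ∃ p ∈ MvPolynomial.restrictTotalDegree (Fin N) (ZMod 2) d, ∀ x, MvPolynomial.eval x p = f x := by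
  classical
  have key : Pdeg (univ : Finset (Fin N)) d ≤ (MvPolynomial.restrictTotalDegree (Fin N) (ZMod 2) d).map evalFun := by
    refine Submodule.span_le.2 ?_
    rintro f ⟨S, -, hc, rfl⟩
    refine Submodule.mem_map.mpr ⟨∏ i ∈ S, X i, ?_, ?_⟩
    · rw [MvPolynomial.mem_restrictTotalDegree]
      refine (totalDegree_finsetProd _ _).trans ?_
      calc ∑ i ∈ S, (X i : MvPolynomial (Fin N) (ZMod 2)).totalDegree ≤ ∑ _i ∈ S, 1 :=
            sum_le_sum fun i _ => (totalDegree_X _).le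
        _ = S.card := by simp
        _ ≤ d := hc
    · funext x
      show MvPolynomial.eval x (∏ i ∈ S, X i) = chi S x
      rw [map_prod]
      exact prod_congr rfl fun i _ => eval_X _
  obtain ⟨p, hp, hpf⟩ := Submodule.mem_map.mp (key hf)
  exact ⟨p, hp, fun x => congrFun hpf x⟩

/-! ## Corollary 6 and Theorem 7 in `Φ` form -/

/-- **Lemma 5 / Corollary 6 (nonlinear Lemma Z): the sublevel sets of `predErr g` are independent in degree `d`,
so `HF_Y(d) ≥ #{y ∈ Y : predErr g y ≤ d}`.** -/
theorem card_filter_predErr_le_HF (Y : Finset (V N)) (g : (t : Fin N) → (Fin t → ZMod 2) → ZMod 2)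
    (d : ℕ) : (Y.filter fun y => predErr g y ≤ d).card ≤ HF Y d := by
  classical
  set Yd := Y.filter fun y => predErr g y ≤ d with hYd
  set R := MvPolynomial.restrictTotalDegree (Fin N) (ZMod 2) d with hR
  -- restriction from `Y` to `Y_d`
  let res : (Y → ZMod 2) →ₗ[ZMod 2] (Yd → ZMod 2) :=
    { toFun := fun f v => f ⟨v.1, (mem_filter.mp v.2).1⟩
      map_add' := fun _ _ => rfl
      map_smul' := fun _ _ => rfl }
  have hcomp : (R.map (evalOn Y)).map res = R.map (evalOn Yd) := by
    rw [← Submodule.map_comp]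
    congr 1
  -- every function on `Y_d` is a polynomial function of degree `≤ d`
  have htop : R.map (evalOn Yd) = ⊤ := by
    refine eq_top_iff.mpr fun h _ => ?_
    -- extend `h` by zero to the sublevel set, interpolate there
    set B := univ.filter fun y : V N => predErr g y ≤ d with hB
    have hYB : ∀ v ∈ Yd, v ∈ B := fun v hv => by
      rw [hB]; exact mem_filter.mpr ⟨mem_univ _, (mem_filter.mp hv).2⟩
    let hB' : B → ZMod 2 := fun v => if hv : v.1 ∈ Yd then h ⟨v.1, hv⟩ else 0
    obtain ⟨⟨f, hf⟩, hfB⟩ := evalB_surjective g d hB'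
    obtain ⟨p, hp, hpf⟩ := exists_poly_of_mem_Pdeg hf
    refine Submodule.mem_map.mpr ⟨p, hp, ?_⟩
    funext v
    have h1 : f v.1 = hB' ⟨v.1, hYB v.1 v.2⟩ := congrFun hfB ⟨v.1, hYB v.1 v.2⟩
    have h2 : hB' ⟨v.1, hYB v.1 v.2⟩ = h v := by
      show (if hv : v.1 ∈ Yd then h ⟨v.1, hv⟩ else 0) = h v
      rw [dif_pos v.2]
    show MvPolynomial.eval (v : V N) p = h v
    rw [hpf, h1, h2]
  have hle : Module.finrank (ZMod 2) ((R.map (evalOn Y)).map res) ≤ Module.finrank (ZMod 2) (R.map (evalOn Y)) :=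
    Submodule.finrank_map_le res _
  rw [hcomp, htop, finrank_top, Module.finrank_pi, Fintype.card_coe] at hle
  exact hle

/-- **Corollary 6: `Φ(Y) ≤ Σ_y |φ(y)|` for every triangular predictor.** -/
theorem Phi_le_sum_predErr (Y : Finset (V N)) (g : (t : Fin N) → (Fin t → ZMod 2) → ZMod 2) :
    Phi Y ≤ ∑ y ∈ Y, predErr g y := by
  classical
  unfold Phi
  rw [sum_eq_sum_card_lt Y (predErr g) (fun y _ => predErr_le g y)]
  refine sum_le_sum fun d _ => ?_
  have h1 := card_filter_predErr_le_HF Y g d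
  have h2 := Finset.card_filter_add_card_filter_not (s := Y) (fun y => predErr g y ≤ d)
  have h3 : (Y.filter fun y => ¬ predErr g y ≤ d) = Y.filter fun y => d < predErr g y :=
    filter_congr fun y _ => not_le
  rw [h3] at h2
  omega

/-- **Theorem 7 in `Φ` form (identity order; any `σ` by relabelling): `2Φ(Y) ≤ cap_σ(Y)`.** -/
theorem two_Phi_le_capId (Y : Finset (V N)) : 2 * Phi Y ≤ capId Y := by
  rw [← two_mul_sum_predErr_maj Y]
  exact Nat.mul_le_mul_left 2 (Phi_le_sum_predErr Y (maj Y))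

end Summit.PneNP.PneNP.Theorems.ClusHilbert
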